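import Summits.BirchSwinnertonDyer.Rank1Residual.X11b.MaxUnramifiedRestriction
import Literature.NumberTheory.GaloisRepresentations.PrimeToPEulerChar
import Literature.NumberTheory.GaloisCohomology.KolyvaginSystems
import Literature.NumberTheory.GaloisRepresentations.DecompositionGroupOfCompletion
import Literature.NumberTheory.Automorphic.AdicCompletionResidueCard
import HarnessLib

/-!
# Kolyvagin-prime LOCAL SHAPE, part (U): `#H¹_ur(K_𝔮, T̄) = #T̄^{Γ_{K_𝔮}} = #T̄/(Fr_𝔮 − 1)T̄`
# (cell `b2b-bsdres`, team n1011, row T-R1-16-LOC, p18; consumer p11's R1-16 binder (U))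

HONEST FRAMING (cell `b2b-bsdres`, run/shared/lean/b2b/bsd-rank1-residual/, verbatim in every
file): the goal of the cell is to DELETE the COMBINATION-SHAPED residual classes of the
Birch–Swinnerton-Dyer formula for ALL analytic-rank `≤ 1` elliptic curves over `ℚ` — "full BSD
formula for every rank `≤ 1` curve in class `C`" assembled STRICTLY from published theorems — so
that the rank-`≤ 1` remainder becomes exactly the CONSTRUCTION-SHAPED classes, which are TYPED
(missing-input `Prop`s), NOT attempted. This is not "finishing BSD". Team n1011 (N10/N11, the
additive block `X4 ∧ p = 3`): research route; TOOL theorems of local Galois cohomology, no class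
theorem, nothing booked, no mark changed; no definition, no named fact.

## Content

* `natCard_unramifiedSubgroup_eq_natCard_invariants` — for a non-archimedean local field `F` and a
  finite discrete `Γ_F`-module `W` on which the INERTIA group acts trivially (an unramified module),
  `#H¹_ur(F, W) = #W^{Γ_F}`: `H¹_ur = ker (H¹(F, W) → H¹(F^{nr}, W))` consists of the classes of
  cocycles vanishing on `I_F` (`X11b.LocBridge.mem_unramifiedSubgroup_one_iff_forall_eq_zero`), i.e.
  of the image of the (injective) inflation `H¹(Γ_F/I_F, W) → H¹(F, W)` (inflation–restriction,
  `infOne_exact_resSubgroup`), and `#H¹(Γ_F/I_F, W) = #W^{Γ_F/I_F}` (`h⁰ = h¹` over `Ẑ`,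
  `natCard_continuousCohomology_one_quotient_galUnr`).  Rubin, PCMI Prop. 1.4.13 (1)
  (`H¹_u(K, A) ≅ A/(ϕ − 1)A`) as a COUNT; Milne *ADT* I Lemma 2.9.

References: K. Rubin, *Euler systems and Kolyvagin systems* (PCMI 18, 2011) Prop. 1.4.13, 1.9.5
[Rubin2011]; B. Mazur, K. Rubin, Mem. AMS 799 (2004) Lemma 1.2.1 [MazurRubin2004]; J. S. Milne,
*Arithmetic Duality Theorems* (2006) I Lemma 2.9 [MilneADT2006].
-/

noncomputable section

open scoped Classical

universe u

namespace Summit.BirchSwinnertonDyer.Rank1Residual.GaloisImage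

open CategoryTheory ContinuousCohomology Function Field ValuativeRel NumberField IsDedekindDomain
open Literature.NumberTheory.GaloisRepresentations
open Literature.NumberTheory.GaloisRepresentations.IsNonarchimedeanLocalField
open _root_.TopRep
open Literature.NumberTheory.GaloisCohomology
open scoped NumberField

/-! ## (U), generic: `#H¹_ur(F, W) = #W^{Γ_F}` for an unramified finite module -/

section Unramified

variable {F : Type u} [Field F] [ValuativeRel F] [TopologicalSpace F] [IsNonarchimedeanLocalField F]
variable {W : Type u} [AddCommGroup W] [TopologicalSpace W] [DiscreteTopology W] [Finite W]
  (ρ : DiscreteGaloisModule F W)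

omit [Finite W] in
/-- **`[φ] ∈ H¹_ur(F, W)` iff the restriction of `[φ]` to the inertia group `Gal(F̄/F^{nr})`
vanishes**, for `W` with trivial inertia action (both say: `φ` vanishes on `I_F`).
[cite: MilneADT2006, Ch. I §2 (unramified cohomology)] -/
theorem mem_unramifiedSubgroup_one_iff_resSubgroup_galUnr_eq_zero
    (hI : ∀ τ ∈ absInertia F, ∀ w : W, ρ τ w = w) (φ : contOneCocycles ρ.toTopRep) :
    oneCocycleClass ρ.toTopRep φ ∈ DiscreteGaloisModule.unramifiedSubgroup ρ 1 ↔
      resSubgroup ρ.toTopRep (galUnr F) 1 (oneCocycleClass ρ.toTopRep φ) = 0 := by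
  rw [X11b.LocBridge.mem_unramifiedSubgroup_one_iff_forall_eq_zero ρ hI φ,
    resSubgroup_oneCocycleClass, oneCocycleClass_eq_zero_iff]
  constructor
  · intro h
    refine ⟨0, fun n => ?_⟩
    rw [contOneCocycles.pullback_apply, map_zero, sub_zero]
    exact h n (by rw [← galUnr_eq_absInertia F]; exact n.2)
  · rintro ⟨w, hw⟩ τ hτ
    have hτ' : τ ∈ galUnr F := by rw [galUnr_eq_absInertia F]; exact hτ
    have h := hw ⟨τ, hτ'⟩
    rw [contOneCocycles.pullback_apply] at h
    -- the inertia group acts trivially: the coboundary vanishes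
    have htriv : (subgroupRep ρ.toTopRep (galUnr F)).ρ ⟨τ, hτ'⟩ w = w := hI τ hτ w
    rw [htriv, sub_self] at h
    exact h

/-- **`#H¹_ur(F, W) = #W^{Γ_F}` for a finite unramified `W`** (Rubin PCMI Prop. 1.4.13 (1),
`H¹_u(K, A) = H¹(K^{ur}/K, A) ≅ A/(ϕ − 1)A`, as a count; Milne *ADT* I Lemma 2.9): `H¹_ur` is the
image of the injective inflation from `Γ_F/I_F` (inflation–restriction) and `h¹ = h⁰` for finite
modules over `Γ_F/I_F ≅ Ẑ`. [cite: Rubin2011, Prop. 1.4.13 (1) (p. 9)] [cite: MilneADT2006, Ch. I, Lemma 2.9] -/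
theorem natCard_unramifiedSubgroup_eq_natCard_invariants
    (hI : ∀ τ ∈ absInertia F, ∀ w : W, ρ τ w = w) :
    Nat.card (DiscreteGaloisModule.unramifiedSubgroup ρ 1) = Nat.card ρ.toTopRep.ρ.invariants := by
  haveI := absoluteGaloisGroup_compactSpace F
  set N : Subgroup (absoluteGaloisGroup F) := galUnr F
  have hex := infOne_exact_resSubgroup N ρ
  -- every unramified class is inflated, and conversely
  have hmem : ∀ c : galoisCohomology ρ 1,
      c ∈ DiscreteGaloisModule.unramifiedSubgroup ρ 1 ↔ c ∈ Set.range (infOne N ρ) := by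
    intro c
    obtain ⟨φ, rfl⟩ := oneCocycleClass_surjective ρ.toTopRep c
    exact (mem_unramifiedSubgroup_one_iff_resSubgroup_galUnr_eq_zero ρ hI φ).trans (hex _)
  have e : continuousCohomology 1 (ρ.quotientInvariants N).toTopRep ≃
      DiscreteGaloisModule.unramifiedSubgroup ρ 1 :=
    Equiv.ofBijective (fun x => ⟨infOne N ρ x, (hmem _).mpr ⟨x, rfl⟩⟩)
      ⟨fun x y hxy => infOne_injective N ρ (congrArg Subtype.val hxy),
        fun c => by
          obtain ⟨x, hx⟩ := (hmem c.1).mp c.2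
          exact ⟨x, Subtype.ext hx⟩⟩
  rw [← Nat.card_congr e, natCard_continuousCohomology_one_quotient_galUnr F _ (ρ.quotientInvariants N)]
  exact Nat.card_congr (invariantsQuotientInvariantsEquiv N ρ)

/-! ## Invariants of an unramified module = fixed points of a Frobenius -/

omit [Finite W] in
/-- **On an unramified module the `Γ_F`-invariants are the fixed points of any Frobenius**: if the
inertia group acts trivially on `W` and `φ ∈ Γ_F` is a Frobenius power of exponent `1`, then
`w ∈ W^{Γ_F} ↔ φ w = w` (the Frobenius topologically generates `Γ_F/I_F`: every coset of an open
normal subgroup of `Γ_F/I_F` is a Frobenius power, `exists_pow_eq_mk_quotient`; the stabiliser of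
`w` is open).  Serre, *Local Fields*, XIII §1; Rubin PCMI §1.4. [cite: SerreLocalFields1979, XIII §1 Prop. 1] -/
theorem forall_apply_eq_iff_of_isFrobPow (hI : ∀ τ ∈ absInertia F, ∀ w : W, ρ τ w = w)
    {φ : absoluteGaloisGroup F} (hφ : IsFrobPow φ 1) (w : W) :
    (∀ g : absoluteGaloisGroup F, ρ g w = w) ↔ ρ φ w = w := by
  refine ⟨fun h => h φ, fun hw g => ?_⟩
  haveI := absoluteGaloisGroup_compactSpace F
  -- an open normal subgroup of `Γ_F` fixing `w`
  have hst : {σ : absoluteGaloisGroup F | ρ σ w = w} ∈ nhds (1 : absoluteGaloisGroup F) :=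
    ρ.setOf_apply_eq_mem_nhds_one w
  have h1 : (1 : absoluteGaloisGroup F) ∈ interior {σ : absoluteGaloisGroup F | ρ σ w = w} :=
    mem_interior_iff_mem_nhds.2 hst
  obtain ⟨V, hV⟩ := ProfiniteGrp.exist_openNormalSubgroup_sub_open_nhds_of_one isOpen_interior h1
  have hVw : ∀ v ∈ (V : Subgroup (absoluteGaloisGroup F)), ρ v w = w := fun v hv => by
    have h : v ∈ {σ : absoluteGaloisGroup F | ρ σ w = w} := interior_subset (hV hv)
    exact h
  -- its image in `Γ_F / I_F` is open and normal; the Frobenius generates the quotient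
  set N : Subgroup (absoluteGaloisGroup F) := galUnr F
  let H₀ : Subgroup (absoluteGaloisGroup F ⧸ N) :=
    (V : Subgroup (absoluteGaloisGroup F)).map (QuotientGroup.mk' N)
  haveI : H₀.Normal := Subgroup.Normal.map inferInstance _ (QuotientGroup.mk'_surjective _)
  have hH₀o : IsOpen (H₀ : Set (absoluteGaloisGroup F ⧸ N)) := by
    change IsOpen ((QuotientGroup.mk' N) '' ((V : Subgroup (absoluteGaloisGroup F)) :
      Set (absoluteGaloisGroup F)))
    exact QuotientGroup.isOpenMap_coe ((V : Subgroup (absoluteGaloisGroup F)) :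
      Set (absoluteGaloisGroup F)) V.isOpen
  obtain ⟨i, hi⟩ := exists_pow_eq_mk_quotient F H₀ hH₀o hφ
    (QuotientGroup.mk (QuotientGroup.mk g : absoluteGaloisGroup F ⧸ N))
  -- unwind: `g = φ^i * n * v` with `v ∈ V`, `n ∈ I_F`
  rw [← QuotientGroup.mk_pow, QuotientGroup.eq] at hi
  -- `hi : (mk g)⁻¹ * mk (φ ^ i) ∈ H₀`
  obtain ⟨v, hv, hv'⟩ := hi
  have hv'' : (QuotientGroup.mk v : absoluteGaloisGroup F ⧸ N) = QuotientGroup.mk (g⁻¹ * φ ^ i) := by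
    rw [QuotientGroup.mk_mul, QuotientGroup.mk_inv, QuotientGroup.mk_pow]
    exact hv'
  rw [QuotientGroup.eq] at hv''
  -- `hv'' : v⁻¹ * (g⁻¹ * φ ^ i) ∈ N`
  have hn : ρ (v⁻¹ * (g⁻¹ * φ ^ i)) w = w :=
    hI _ (by rw [← galUnr_eq_absInertia F]; exact hv'') w
  have hpow : ∀ j : ℕ, ρ (φ ^ j) w = w := fun j => by
    induction j with
    | zero => rw [pow_zero, map_one, Module.End.one_apply]
    | succ j ih => rw [pow_succ, map_mul, Module.End.mul_apply, hw, ih]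
  -- `g = φ^i * (v⁻¹ * (g⁻¹ * φ^i))⁻¹ * v⁻¹`
  have hg : g = φ ^ i * (v⁻¹ * (g⁻¹ * φ ^ i))⁻¹ * v⁻¹ := by group
  have hvinv : ρ v⁻¹ w = w := hVw _ (V.inv_mem' hv)
  have hninv : ρ (v⁻¹ * (g⁻¹ * φ ^ i))⁻¹ w = w := by
    have h := congrArg (ρ (v⁻¹ * (g⁻¹ * φ ^ i))⁻¹) hn
    rw [← Module.End.mul_apply, ← map_mul, inv_mul_cancel, map_one, Module.End.one_apply] at h
    exact h.symm
  rw [hg, map_mul, map_mul, Module.End.mul_apply, Module.End.mul_apply, hvinv, hninv, hpow]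

/-- `#ker δ = #(W / δ W)` for an endomorphism `δ` of a finite abelian group (both equal
`#W / #δ(W)`). [folklore] -/
theorem natCard_ker_eq_natCard_quotient_range {A : Type*} [AddCommGroup A] [Finite A] (δ : A →+ A) :
    Nat.card δ.ker = Nat.card (A ⧸ δ.range) := by
  have h1 := AddSubgroup.card_eq_card_quotient_mul_card_addSubgroup δ.range
  have h2 := AddSubgroup.card_eq_card_quotient_mul_card_addSubgroup δ.ker
  rw [Nat.card_congr (QuotientAddGroup.quotientKerEquivRange δ).toEquiv] at h2
  have hpos : 0 < Nat.card δ.range := Nat.card_pos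
  rw [h2, mul_comm] at h1
  exact Nat.eq_of_mul_eq_mul_right hpos h1

omit [Finite W] in
/-- **`W^{Γ_F} = W^{φ = 1}`** as a count-free bijection statement: for an unramified `W` and a
Frobenius `φ`, `#W^{Γ_F} = #{w | φ w = w}`. [cite: SerreLocalFields1979, XIII §1 Prop. 1] -/
theorem natCard_invariants_eq_natCard_fixedPoints_of_isFrobPow
    (hI : ∀ τ ∈ absInertia F, ∀ w : W, ρ τ w = w)
    {φ : absoluteGaloisGroup F} (hφ : IsFrobPow φ 1) :
    Nat.card ρ.toTopRep.ρ.invariants = Nat.card {w : W // ρ φ w = w} :=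
  Nat.card_congr
    { toFun := fun v => ⟨v.1, (forall_apply_eq_iff_of_isFrobPow ρ hI hφ v.1).1 fun g => v.2 g⟩
      invFun := fun v => ⟨v.1, fun g => (forall_apply_eq_iff_of_isFrobPow ρ hI hφ v.1).2 v.2 g⟩
      left_inv := fun _ => rfl
      right_inv := fun _ => rfl }

/-- **`#W^{Γ_F} = #(W / (φ − 1)W)`** for an unramified finite `W` and a Frobenius `φ`: the
invariants are `ker (φ − 1)` (`forall_apply_eq_iff_of_isFrobPow`) and `#ker = #coker` for an
endomorphism of a finite group.  With `natCard_unramifiedSubgroup_eq_natCard_invariants`: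
`#H¹_ur(F, W) = #W/(φ − 1)W` (Rubin PCMI Prop. 1.4.13 (1)). [cite: Rubin2011, Prop. 1.4.13 (1) (p. 9)] -/
theorem natCard_invariants_eq_natCard_quotient_range_of_isFrobPow
    (hI : ∀ τ ∈ absInertia F, ∀ w : W, ρ τ w = w)
    {φ : absoluteGaloisGroup F} (hφ : IsFrobPow φ 1) :
    Nat.card ρ.toTopRep.ρ.invariants =
      Nat.card (W ⧸ ((ρ φ).toAddMonoidHom - AddMonoidHom.id W).range) := by
  rw [natCard_invariants_eq_natCard_fixedPoints_of_isFrobPow ρ hI hφ,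
    ← natCard_ker_eq_natCard_quotient_range]
  refine Nat.card_congr (Equiv.subtypeEquivRight fun w => ?_)
  rw [AddMonoidHom.mem_ker, AddMonoidHom.sub_apply, sub_eq_zero]
  rfl

end Unramified

/-! ## (U) at the Kolyvagin primes relative to `τ`: `#H¹_ur(K_𝔮, T̄) = #T̄/(τ − 1)T̄` -/

section FrobeniusClass

variable {K : Type u} [Field K] [NumberField K] {M : Type u} [AddCommGroup M] [TopologicalSpace M]
  [DiscreteTopology M] [Finite M] (ρ : DiscreteGaloisModule K M)

omit [NumberField K] [Finite M] in
/-- `ρ (a * b⁻¹) = 1 ⟹ ρ a = ρ b` (as endomorphisms). [folklore] -/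
theorem apply_eq_apply_of_apply_mul_inv_eq_one {a b : absoluteGaloisGroup K} (h : ρ (a * b⁻¹) = 1) :
    ρ a = ρ b := by
  calc ρ a = ρ (a * b⁻¹ * b) := by rw [inv_mul_cancel_right]
    _ = ρ (a * b⁻¹) * ρ b := map_mul _ _ _
    _ = ρ b := by rw [h, one_mul]

/-- **`#T̄^{Γ_{K_𝔮}} = N` at a Kolyvagin prime `𝔮` relative to `τ` with `T̄/(τ − 1)T̄ ≃ ℤ/N`**: the
invariants of the LOCAL module `GaloisRep.toLocal 𝔮 ρ` number `N`.  The local inertia acts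
trivially (`GaloisRep.isUnramifiedAt_iff_toLocal_holds`), so the invariants are the fixed points of
a local Frobenius `φ` (`natCard_invariants_eq_natCard_fixedPoints_of_isFrobPow`); the restriction
of `φ` to `K̄` is an arithmetic Frobenius at the prime `𝔓₀ ∣ 𝔮` of the completion
(`isArithFrobAt_absGaloisRestrict_adicCompletionPrime_iff`), hence — transitivity of `Γ_K` on the
primes above `𝔮`, `IsArithFrobAt.conj`, `IsArithFrobAt.mul_inv_mem_inertia` and unramifiedness —
acts on `M` as a `ρ(Γ_K)`-conjugate of `ρ(σ) = ρ(τ)`; so `#M^{φ=1} = #M^{τ=1} = #M/(τ − 1)M = N`.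
[cite: Rubin2011, Def. 2.1.3 (p. 17)] [cite: Sakamoto2024, §2 (pp. 920–921), the set 𝒫] -/
theorem natCard_invariants_toLocal_of_mem_frobeniusClassPrimes
    {S : Set (HeightOneSpectrum (𝓞 K))} {τ : absoluteGaloisGroup K} {N : ℕ}
    {q : HeightOneSpectrum (𝓞 K)} (hq : q ∈ frobeniusClassPrimes ρ S τ N)
    (hτ : Nonempty (cokerSubOne ρ τ ≃+ ZMod N)) :
    Nat.card (GaloisRep.toLocal q ρ).toTopRep.ρ.invariants = N := by
  classical
  obtain ⟨-, -, hunr, σ, hσ, hστ, -⟩ := hq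
  set L := q.adicCompletion K
  -- the local inertia group acts trivially on `M`
  have hI : ∀ t ∈ absInertia L, ∀ m : M, GaloisRep.toLocal q ρ t m = m := by
    intro t ht m
    have h := (GaloisRep.isUnramifiedAt_iff_toLocal_holds q ρ).1 hunr t ht
    rw [h]
    rfl
  -- a local arithmetic Frobenius `φ`
  obtain ⟨φ, hφ⟩ := exists_isAbsArithFrob_holds L
  have hφ1 : IsFrobPow φ 1 := IsAbsArithFrob.isFrobPow_holds hφ
  rw [natCard_invariants_eq_natCard_fixedPoints_of_isFrobPow (GaloisRep.toLocal q ρ) hI hφ1]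
  -- its restriction to `K̄` is a Frobenius at `𝔓₀`, conjugate to `σ` up to inertia
  have hres : IsArithFrobAt (𝓞 K) (absGaloisRestrict K L φ) (adicCompletionPrime K q) :=
    (isArithFrobAt_absGaloisRestrict_adicCompletionPrime_iff K q
      (by rw [Literature.NumberTheory.Automorphic.residueFieldCard_adicCompletion_eq K q,
        HeightOneSpectrum.residueCard_eq_card_quotient]) φ).2 hφ
  obtain ⟨𝔓, h𝔓, hσ𝔓⟩ := hσ
  obtain ⟨g, hg⟩ := HeightOneSpectrum.exists_smul_eq_of_mem_primesAbove_holds (adicCompletionPrime_mem_primesAbove K q) h𝔓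
  have hconj : IsArithFrobAt (𝓞 K) (g * absGaloisRestrict K L φ * g⁻¹) 𝔓 := hg ▸ hres.conj g
  have htriv : ρ (σ * (g * absGaloisRestrict K L φ * g⁻¹)⁻¹) = 1 :=
    hunr 𝔓 h𝔓 _ (hσ𝔓.mul_inv_mem_inertia hconj)
  -- `ρ σ = ρ τ` and `ρ (res φ) = ρ g⁻¹ ∘ ρ τ ∘ ρ g`
  have hστ' : ρ (σ * τ⁻¹) = 1 := LinearMap.ext fun m => hστ m
  have hρφ : ρ (absGaloisRestrict K L φ) = ρ g⁻¹ * ρ τ * ρ g := by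
    rw [← apply_eq_apply_of_apply_mul_inv_eq_one ρ hστ',
      apply_eq_apply_of_apply_mul_inv_eq_one ρ htriv, ← map_mul, ← map_mul]
    congr 1
    group
  -- fixed points of `φ` on the local module ↔ fixed points of `τ`, via `m ↦ g m`
  have hloc : ∀ m : M, GaloisRep.toLocal q ρ φ m = ρ (absGaloisRestrict K L φ) m := fun _ => rfl
  have e : {m : M // GaloisRep.toLocal q ρ φ m = m} ≃ {m : M // ρ τ m = m} :=
    { toFun := fun m => ⟨ρ g m.1, by
        have h := m.2
        rw [hloc, hρφ, Module.End.mul_apply, Module.End.mul_apply] at h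
        have h' := congrArg (ρ g) h
        rwa [← Module.End.mul_apply (ρ g) (ρ g⁻¹), ← map_mul, mul_inv_cancel, map_one,
          Module.End.one_apply] at h'⟩
      invFun := fun m => ⟨ρ g⁻¹ m.1, by
        rw [hloc, hρφ, Module.End.mul_apply, Module.End.mul_apply, ← Module.End.mul_apply (ρ g) (ρ g⁻¹),
          ← map_mul, mul_inv_cancel, map_one, Module.End.one_apply, m.2]⟩
      left_inv := fun m => Subtype.ext (by
        change ρ g⁻¹ (ρ g m.1) = m.1
        rw [← Module.End.mul_apply, ← map_mul, inv_mul_cancel, map_one, Module.End.one_apply])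
      right_inv := fun m => Subtype.ext (by
        change ρ g (ρ g⁻¹ m.1) = m.1
        rw [← Module.End.mul_apply, ← map_mul, mul_inv_cancel, map_one, Module.End.one_apply]) }
  rw [Nat.card_congr e]
  -- `#M^{τ=1} = #M/(τ − 1)M = #ℤ/N = N`
  have hker : Nat.card {m : M // ρ τ m = m} =
      Nat.card ((ρ τ).toAddMonoidHom - AddMonoidHom.id M).ker := by
    refine Nat.card_congr (Equiv.subtypeEquivRight fun m => ?_)
    rw [AddMonoidHom.mem_ker, AddMonoidHom.sub_apply, sub_eq_zero]
    rfl
  rw [hker, natCard_ker_eq_natCard_quotient_range, Nat.card_congr hτ.some.toEquiv, Nat.card_zmod]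

/-- **(U) — `#H¹_ur(K_𝔮, T̄) = N` at a Kolyvagin prime `𝔮` relative to `τ` with `T̄/(τ − 1)T̄ ≃ ℤ/N`.**
For a finite discrete `Γ_K`-module `T̄ = M`, `τ ∈ Γ_K` with `M/(τ − 1)M ≃ ℤ/N` (the (H.2) datum),
and `𝔮 ∈ frobeniusClassPrimes ρ S τ N` (`𝔮 ∉ S`, `𝔮 ∤ N`, `M` unramified at `𝔮`, `Fr_𝔮` conjugate
to `τ` on `M` and on `μ_N` — Sakamoto's `𝒫`, Rubin's `𝒫` Def. 2.1.3): the unramified classes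
`H¹_ur(K_𝔮, M) ≤ H¹(K_𝔮, M)` of the LOCAL module `GaloisRep.toLocal 𝔮 ρ` number exactly `N`:
`#H¹_ur = #M^{Γ_{K_𝔮}}` (`natCard_unramifiedSubgroup_eq_natCard_invariants`) `= N`
(`natCard_invariants_toLocal_of_mem_frobeniusClassPrimes`).  Rubin PCMI Prop. 1.4.13 (1) +
Def. 2.1.3 (`A/(Fr_ℓ − 1)A` free of rank one) for `R = ℤ/N`, `K` a number field; p11's binder
(U) of R1-16 at `N = p`.
[cite: Rubin2011, Prop. 1.4.13 (1) (p. 9) and Def. 2.1.3 (p. 17)] [cite: Sakamoto2024, §2 (pp. 920–921), the set 𝒫] -/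
theorem natCard_unramifiedSubgroup_toLocal_of_mem_frobeniusClassPrimes
    {S : Set (HeightOneSpectrum (𝓞 K))} {τ : absoluteGaloisGroup K} {N : ℕ}
    {q : HeightOneSpectrum (𝓞 K)} (hq : q ∈ frobeniusClassPrimes ρ S τ N)
    (hτ : Nonempty (cokerSubOne ρ τ ≃+ ZMod N)) :
    Nat.card (DiscreteGaloisModule.unramifiedSubgroup (GaloisRep.toLocal q ρ) 1) = N := by
  have hI : ∀ t ∈ absInertia (q.adicCompletion K), ∀ m : M, GaloisRep.toLocal q ρ t m = m := by
    intro t ht m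
    have h := (GaloisRep.isUnramifiedAt_iff_toLocal_holds q ρ).1 hq.2.2.1 t ht
    rw [h]
    rfl
  rw [natCard_unramifiedSubgroup_eq_natCard_invariants (GaloisRep.toLocal q ρ) hI]
  exact natCard_invariants_toLocal_of_mem_frobeniusClassPrimes ρ hq hτ

/-- **p11's binder (U) of R1-16, literally**: for a Kolyvagin datum `D` whose primes are the
Frobenius-class primes of `τ` at level `N` (`D.primes = frobeniusClassPrimes ρ S τ N`, as in the
N11 instance) and `M/(τ − 1)M ≃ ℤ/N`:
`∀ q ∈ D.primes, Nat.card (unramifiedSubgroup (GaloisRep.toLocal q ρ) 1) = N`.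
[cite: Rubin2011, Prop. 1.4.13 (1) (p. 9) and Def. 2.1.3 (p. 17)] -/
theorem natCard_unramifiedSubgroup_toLocal_of_primes_eq {D : KolyvaginDatum ρ}
    {S : Set (HeightOneSpectrum (𝓞 K))} {τ : absoluteGaloisGroup K} {N : ℕ}
    (hP : D.primes = frobeniusClassPrimes ρ S τ N) (hτ : Nonempty (cokerSubOne ρ τ ≃+ ZMod N)) :
    ∀ q ∈ D.primes, Nat.card (DiscreteGaloisModule.unramifiedSubgroup (GaloisRep.toLocal q ρ) 1) = N :=
  fun _ hq => natCard_unramifiedSubgroup_toLocal_of_mem_frobeniusClassPrimes ρ (hP ▸ hq) hτ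

end FrobeniusClass

end Summit.BirchSwinnertonDyer.Rank1Residual.GaloisImage

end
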